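import Literature.MathematicalPhysics.QuantumFieldTheory.Balaban1985CMP102.Theorems
import Literature.MathematicalPhysics.QuantumFieldTheory.Balaban1983to89.B10Ineq3Terminal
import Literature.MathematicalPhysics.QuantumFieldTheory.Balaban1983to89.B10Eq6DensityLevel
import Summits.QuantumFields.Balaban3D.Proofs.ScalesArithmetic

/-!
# Bałaban CMP 102 (1985), d = 3 lane — `Proofs.Terminal3`: **(3)** p. 256 from **(5)** at the terminal scale `k = K`, and
# the ε-uniform bounds on `Z^ε` of **(6)** p. 257, for the concrete run objects `Setting.RunObjects`

Source: T. Bałaban, *Ultraviolet stability of three-dimensional lattice pure gauge field theories*, Commun. Math. Phys.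
**102** (1985) 255–275 [Balaban1985UV3] ([B10]; `paper:balaban1985-cmp102-uv-stability-3d`; PDF page = journal page − 254;
p. 256 = PDF 2, p. 257 = PDF 3).  Lane `pub-balaban3d`, seat p3 (PLAN.md §3.1 p3 «(6)/(3) for `run3` (`B10Eq6PartitionLower`,
`B10Ineq3Terminal`)»).

THE PRINTED TEXT.  p. 256 L19–29: «The ultraviolet stability means that the actions ρ_K have bounds independent of the
lattice spacing ε. In our case field configurations have values in the compact Lie group G, hence bounds are in uniform
norms, and can be written in a simplest way as  χ(U)e^{−O(1)|T_ε|} ≤ ρ_K(U) ≤ e^{O(1)|T_ε|},  |T_ε| = Σ_{x∈T_ε} ε³,  (3)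
with a constant O(1) depending on g and ε₀ only. The function χ(U) is a characteristic function of the domain |U(∂p) − 1| <
ε₁, p ⊂ T₁^{(K)}, (4) … The constant O(1) goes to ∞ as g → 0. To get a better bound we have to write explicitly the
expression divergent with g.» — then (5).  p. 257 L11–14: «The bounds (5) imply bounds for partition functions, i.e. for the
integrals ∫dUρ_k(U), hence by normalization identities  ∫dUρ_k = ∫dUT^kρ₀ = ∫dUρ₀ = Z^ε,  (6)  they imply uniform in ε
bounds for the partition function Z^ε.»

WHAT THIS FILE PROVES (kernel-checked; no `sorry`; standard axioms) over the spine's CONCRETE objects (`Setting.Scales`,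
`Setting.RunObjects`, `Theorems.Construction`):
* §1 the characteristic function (4) of the run objects takes values in `{0, 1}` (`chi_nonneg`, `chi_le_one`, `chi_eq_one_of`).
* §2 **(5)_K ⇒ (3) for one run** (`bounds3_of_bounds5At`): `B10.Bounds5At R.toRunData O1 K` and the integrated regularity
  input `A^η(U_K(U)) ≤ a|T₁^{(K)}|` on the support of `χ` give `RunObjects.Bounds3 R (ε₀⁻³(O1 + a/(g²ε₀)))` — the 4D
  cell's `B10Ineq3Terminal.ineq3_of_bounds5At` fed with the terminal-scale identities `|T₁^{(K)}| = ε₀⁻³|T_ε|`, `g_K = gε₀^{1/2}`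
  of `Proofs.ScalesArithmetic`; the constant is «depending on g and ε₀ only».
* §3 **THEOREM 1 (compact reading) ⇒ (3) WITH ITS UNIFORMITY CLAUSE for a construction** (`uvStability3_of_thm1AsPrintedCompact`):
  `Theorems.Thm1AsPrintedCompact mk → Reg44ActionBound mk → Theorems.UVStability3AsPrinted mk` — spine declarations BY NAME
  on both sides (`Theorems` v3: «∃ eps0» family clause on both, the same witness serves); the coupling window used is the ONE
  point `g_K = g·eps0(g)^{1/2}` shared by every lattice approximation with coupling `g` in the family.  The middle hypothesis `Reg44ActionBound` is the regularity (44) p. 267 L1–3 of the minimizer at `k = K` in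
  integrated form — NOT a printed display (reported NOT-IN-PRINT to the lead; to be discharged from binder b11 via (44) + (11)).
* §4 **(6) ⇒ ε-uniform bounds for `Z^ε`**: from the identity (6) (`RunObjects.Eq6`, spine binder; carrier seat p1 proves it
  for the chosen `T`) and (5)_K: `Z^ε ≤ exp(O1·ε₀⁻³|T_ε|)` (`Zeps_le_of_bounds5At`; no integrability needed), and from (3):
  `exp(−O1|T_ε|)·m(δ)^{3ε₀⁻³|T_ε|} ≤ Z^ε` for `4δ ≤ ε₁(K)`, `m(δ)` = the Haar volume of `{|g − 1| < δ}` (`Zeps_ge_of_bounds3`,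
  via `B10Eq6DensityLevel.integral_ge_of_lower`; the exponent `#bonds(T₁^{(K)}) = 3|T₁^{(K)}| = 3ε₀⁻³|T_ε|` by
  `card_pbond_K_eq`) — both sides functions of `g`, `ε₀`, `|T_ε|`, `O1` only: «uniform in ε».
HONEST FRAMING (PLAN §0): bookkeeping between printed displays over the concrete objects; every analytic input ((5), (6),
the regularity of `U_K`) is a hypothesis named by a spine declaration or by `Reg44ActionBound`.  Not summit progress.
-/

namespace Summit.QuantumFields.Balaban3D.Proofs.Terminal3

open _root_.MeasureTheory
open Literature.MathematicalPhysics.QuantumFieldTheory.Balaban1983to89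
open Literature.MathematicalPhysics.QuantumFieldTheory.Balaban1985CMP102.Setting
open Literature.MathematicalPhysics.QuantumFieldTheory.Balaban1985CMP102.Theorems
open Summit.QuantumFields.Balaban3D.Proofs.ScalesArithmetic

variable {L : ℕ} {S : Scales L} {G : Type} [GaugeGroup G] [MeasurableSpace G] [HaarData G]

/-! ## §1 The characteristic function (4) -/

/-- `χ ≥ 0` ((4) p. 256: a characteristic function; `Setup.chiSmall` is an indicator). [cite: Balaban1985UV3, (4) p.256] -/
theorem chi_nonneg (R : RunObjects S G) (k : ℕ) (U : GaugeField S.P k G) : 0 ≤ R.chi k U := by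
  unfold RunObjects.chi chiSmall
  split_ifs <;> norm_num

/-- `χ ≤ 1`. [cite: Balaban1985UV3, (4) p.256] -/
theorem chi_le_one (R : RunObjects S G) (k : ℕ) (U : GaugeField S.P k G) : R.chi k U ≤ 1 := by
  unfold RunObjects.chi chiSmall
  split_ifs <;> norm_num

/-- On the domain (4) «|U(∂p) − 1| < ε₁, p ⊂ T₁^{(k)}» the characteristic function is `1`. [cite: Balaban1985UV3, (4) p.256] -/
theorem chi_eq_one_of (R : RunObjects S G) (k : ℕ) (U : GaugeField S.P k G) (hU : PlaqSmall (R.ε₁ k) U) :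
    R.chi k U = 1 := by
  unfold RunObjects.chi chiSmall
  rw [if_pos (show PlaqSmallOn Set.univ (R.ε₁ k) U from fun p _ => hU p)]

/-- Off the domain (4) the characteristic function is `0`. [cite: Balaban1985UV3, (4) p.256] -/
theorem chi_eq_zero_of (R : RunObjects S G) (k : ℕ) (U : GaugeField S.P k G) (hU : ¬ PlaqSmall (R.ε₁ k) U) :
    R.chi k U = 0 := by
  unfold RunObjects.chi chiSmall
  rw [if_neg]
  intro h
  exact hU (fun p => h p (Set.mem_univ p))

/-! ## §2 (5) at `k = K` ⇒ (3), for one lattice approximation -/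

/-- **(5)_K ⇒ (3)** (p. 256 L19–29) for the run objects `R` of the lattice approximation `S`: if (5) holds at the terminal
step `K` with constant `O1` (`B10.Bounds5At R.toRunData O1 K`) and, on the support of `χ`, the main term satisfies
`A^η(U_K(U)) ≤ a|T₁^{(K)}|` (`a ≥ 0`), then (3) holds with `O(1) = ε₀⁻³(O1 + a/(g²ε₀))` — «a constant O(1) depending on g and
ε₀ only» (and `→ ∞` as `g → 0`: `B10Ineq3Terminal.ineq3_constant_unbounded`).  Uses `|T₁^{(K)}| = ε₀⁻³|T_ε|`, `g_K = gε₀^{1/2}`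
(`Proofs.ScalesArithmetic`). [cite: Balaban1985UV3, (3) p.256] -/
theorem bounds3_of_bounds5At (R : RunObjects S G) {O1 a : ℝ} (ha : 0 ≤ a)
    (hreg : ∀ U : GaugeField S.P S.K G, R.chi S.K U ≠ 0 → R.mainTerm S.K U ≤ a * S.sites S.K)
    (h5 : B10.Bounds5At R.toRunData O1 S.K) :
    R.Bounds3 (S.ε₀⁻¹ ^ 3 * (O1 + a / (S.g ^ 2 * S.ε₀))) := by
  intro U
  have h : R.chi S.K U * Real.exp (-(S.ε₀⁻¹ ^ 3 * (O1 + a * (S.gk S.K)⁻¹ ^ 2) * S.volT)) ≤ R.rho S.K U ∧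
      R.rho S.K U ≤ Real.exp (S.ε₀⁻¹ ^ 3 * O1 * S.volT) :=
    B10Ineq3Terminal.ineq3_of_bounds5At R.toRunData (O1 := O1) (a := a) (ε₀ := S.ε₀) (Tε := S.volT)
      (sites_K_eq S) (fun U => chi_nonneg R S.K U) (fun U hU => hreg U hU) h5 U
  rw [B10Ineq3Terminal.ineq3_constant_eq (O1 := O1) (a := a) (eps0_pos S) (gk_K_eq S)] at h
  refine ⟨h.1, h.2.trans (Real.exp_le_exp.mpr ?_)⟩
  have hε := eps0_pos S
  have hg := S.g_pos
  have hT := (volT_pos S).le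
  have h1 : (0 : ℝ) ≤ a / (S.g ^ 2 * S.ε₀) := by positivity
  have h2 : (0 : ℝ) ≤ S.ε₀⁻¹ ^ 3 := by positivity
  nlinarith [mul_nonneg (mul_nonneg h2 h1) hT]

/-! ## §3 Theorem 1 (compact reading) ⇒ (3) «with a constant O(1) depending on g and ε₀ only», for a construction -/

/-- THE REGULARITY INPUT OF (3) ⇐ (5), named (NOT a printed display — reported NOT-IN-PRINT to the lane lead): for every group
as printed and every `g`, `ε₀`, ONE `a ≥ 0` such that every lattice approximation `S` of the construction with `S.g = g`,
`S.ε₀ = ε₀` has `A^η(U_K(U)) ≤ a·|T₁^{(K)}|` on the support of `χ` (the domain (4) on `T₁^{(K)}`).  Where it comes from in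
print: (44) p. 267 L1–3 «|U_k(∂p) − 1| < 2L²B₃g_{k−1}p(g_{k−1})η²» (the regularity of the minimizer of [7] = B11 Thm 1, binder
b11) at `k = K`, with «1 − Re tr U(∂p) = ½|U(∂p) − 1|²»-type comparison of (11) p. 258 and `#plaquettes(T_η) = 3η⁻³|T₁^{(K)}|`:
`A^η(U_K(U)) ≤ 6L⁴B₃²·g²_{K−1}p²(g_{K−1})·|T₁^{(K)}|`, and `g²p(g)² = O(1)` on (0, 1] (`B10.gsq_psq_le`).  A hypothesis here;
its discharge belongs to the carrier/first-step seats (p1/p4). [cite: Balaban1985UV3, (44) p.267 + (11) p.258] -/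
def Reg44ActionBound {L : ℕ} (mk : Construction L) : Prop :=
  ∀ (G : Type) [GaugeGroup G] [MeasurableSpace G] [HaarData G] (𝔊 : GroupModel G) (g ε₀ : ℝ),
    ∃ a : ℝ, 0 ≤ a ∧ ∀ S : Scales L, S.g = g → S.ε₀ = ε₀ →
      ∀ U : GaugeField S.P S.K G, (mk G 𝔊 S).chi S.K U ≠ 0 → (mk G 𝔊 S).mainTerm S.K U ≤ a * S.sites S.K

/-- **THEOREM 1 (compact-coupling-window reading) ⇒ (3) with its printed uniformity clause** «with a constant O(1) depending on
g and ε₀ only» (p. 256 L24), for every construction of the run objects: `Theorems.Thm1AsPrintedCompact mk` together with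
`Reg44ActionBound mk` gives `Theorems.UVStability3AsPrinted mk` (`Theorems` v3 shapes: both with the family clause «ε₀ … depending
on the coupling constant g only» as `∃ eps0`; the SAME `eps0` serves).  The window fed to Theorem 1 is the single point
`g_K = g·eps0(g)^{1/2}` common to all lattice approximations of the family with coupling `g` (`ScalesArithmetic.gk_K_eq`), so the
resulting `O1`, hence `eps0(g)⁻³(O1 + a/(g²eps0(g)))`, depends on `g` (and ε₀ = eps0 g) only.  Bookkeeping between spine
declarations; kernel-checked. [cite: Balaban1985UV3, (3) p.256 + Thm 1 p.257] -/
theorem uvStability3_of_thm1AsPrintedCompact {L : ℕ} (mk : Construction L) (hreg : Reg44ActionBound mk)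
    (h1 : Thm1AsPrintedCompact mk) : UVStability3AsPrinted mk := by
  intro G _ _ _ 𝔊
  obtain ⟨eps0, hpos, hO⟩ := h1 G 𝔊
  refine ⟨eps0, hpos, fun g => ?_⟩
  by_cases hg : 0 < g
  · have hε : 0 < eps0 g := hpos g hg
    obtain ⟨a, ha, hreg'⟩ := hreg G 𝔊 g (eps0 g)
    obtain ⟨O1, hO1⟩ := hO (g * Real.sqrt (eps0 g)) (g * Real.sqrt (eps0 g)) (by positivity) le_rfl
    refine ⟨(eps0 g)⁻¹ ^ 3 * (O1 + a / (g ^ 2 * eps0 g)), fun S hSg hSε => ?_⟩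
    have hmem : S.ε₀ = eps0 S.g := by rw [hSε, hSg]
    have hK : S.gk S.K = g * Real.sqrt (eps0 g) := by rw [gk_K_eq, hSg, hSε]
    have h5 : B10.Bounds5At (mk G 𝔊 S).toRunData O1 S.K := hO1 ⟨S, hmem⟩ S.K le_rfl hK.ge hK.le
    have h3 := bounds3_of_bounds5At (mk G 𝔊 S) ha (hreg' S hSg hSε) h5
    rw [hSg, hSε] at h3
    exact h3
  · exact ⟨0, fun S hSg _ => absurd (hSg ▸ S.g_pos) hg⟩

/-! ## §4 (6): ε-uniform bounds for the partition function `Z^ε` -/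

/-- **Upper bound for `Z^ε`** (p. 257 L11–14): the identity (6) `∫dUρ_K = Z^ε` (`RunObjects.Eq6`) and the upper half of (5)
at `k = K` give `Z^ε ≤ exp(O1·|T₁^{(K)}|) = exp(O1·ε₀⁻³|T_ε|)`.  (`dU` is a probability measure: `Step`'s instance
`fieldMeasure_isProbabilityMeasure`; a non-integrable `ρ_K` has Bochner integral `0`, so no integrability hypothesis is needed.)
[cite: Balaban1985UV3, (6) p.257] -/
theorem Zeps_le_of_bounds5At (R : RunObjects S G) (h6 : R.Eq6) {O1 : ℝ} (h5 : B10.Bounds5At R.toRunData O1 S.K) :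
    R.Zeps ≤ Real.exp (O1 * (S.ε₀⁻¹ ^ 3 * S.volT)) := by
  rw [← sites_K_eq S, ← h6 S.K le_rfl]
  have hup : ∀ V : GaugeField S.P S.K G, R.rho S.K V ≤ Real.exp (O1 * S.sites S.K) := fun V => (h5 V).2
  by_cases hi : Integrable (R.rho S.K) (fieldMeasure S.P S.K G)
  · calc ∫ V, R.rho S.K V ∂(fieldMeasure S.P S.K G)
        ≤ ∫ _V, Real.exp (O1 * S.sites S.K) ∂(fieldMeasure S.P S.K G) := integral_mono hi (integrable_const _) hup
      _ = Real.exp (O1 * S.sites S.K) := by simp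
  · rw [integral_undef hi]
    exact (Real.exp_pos _).le

/-- The number of bond variables of `T₁^{(K)}`: `#bonds = 3|T₁^{(K)}| = 3ε₀⁻³|T_ε|` (d = 3; `B10StarCount.card_pbond`,
`ScalesArithmetic.sites_eq_card`, `sites_K_eq`) — ε-INDEPENDENT at fixed `ε₀`, `|T_ε|`. [cite: Balaban1985UV3, (3) p.256] -/
theorem card_pbond_K_eq (S : Scales L) :
    (Fintype.card (PBond S.P S.K) : ℝ) = 3 * (S.ε₀⁻¹ ^ 3 * S.volT) := by
  rw [B10StarCount.card_pbond, P_d, ← sites_K_eq S, sites_eq_card S S.K (by omega)]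
  push_cast
  ring

/-- **Lower bound for `Z^ε`** (p. 257 L11–14 with (3)–(4) p. 256): the identity (6), integrability and the lower half of (3)
— `ρ_K ≥ χ·e^{−O1|T_ε|}`, `χ = 1` on the domain (4) — give, for every window `4δ ≤ ε₁(K)` with `{|g − 1| < δ}` measurable,
`e^{−O1|T_ε|}·m(δ)^{#bonds(T₁^{(K)})} ≤ Z^ε`, `m(δ) = haar{|g − 1| < δ}` and `#bonds(T₁^{(K)}) = 3ε₀⁻³|T_ε|` (`card_pbond_K_eq`):
uniform in ε (`B10Eq6DensityLevel.integral_ge_of_lower`; positivity of `m(δ)` for `U(N)`/`SU(N)` is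
`B10Eq6DensityLevel.haar_dist1Lt_pos_unitaryGroup` / `…_specialUnitaryGroup`). [cite: Balaban1985UV3, (6) p.257] -/
theorem Zeps_ge_of_bounds3 (R : RunObjects S G) (h6 : R.Eq6)
    (hint : Integrable (R.rho S.K) (fieldMeasure S.P S.K G)) {O1 : ℝ} (h3 : R.Bounds3 O1)
    {δ : ℝ} (h4 : 4 * δ ≤ R.ε₁ S.K) (hS : MeasurableSet {g : G | dist1 g < δ}) :
    Real.exp (-(O1 * S.volT)) * (((HaarData.haar : Measure G) {g : G | dist1 g < δ}).toReal)
        ^ Fintype.card (PBond S.P S.K) ≤ R.Zeps := by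
  rw [← h6 S.K le_rfl]
  have h0 : ∀ U : GaugeField S.P S.K G, 0 ≤ R.rho S.K U := fun U =>
    le_trans (mul_nonneg (chi_nonneg R S.K U) (Real.exp_pos _).le) (h3 U).1
  refine B10Eq6DensityLevel.integral_ge_of_lower hint h0 h4 hS (fun U hU => ?_)
  have hχ : R.chi S.K U = 1 := chi_eq_one_of R S.K U (fun p => hU p)
  have h := (h3 U).1
  rw [hχ, one_mul] at h
  exact h

end Summit.QuantumFields.Balaban3D.Proofs.Terminal3
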